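import Summits.ValiantsHypothesis.ValiantsHypothesis.Theorems.NewtonUnitEquationsTwoProductsPermutationTypeFamily
import Summits.ValiantsHypothesis.ValiantsHypothesis.Theorems.NewtonUnitEquationsTwoProductsFormalLogLinearisationLiftedPencilCountBound
import HarnessLib

/-!
# Route NewtonUnitEquations — crux `TwoProducts` (stmt-ValiantsHypothesis-5906), line `relation_ladder`, rung R6 (four-term
# rank one): the SEGRE LIFT — the PROVED SPLIT `BinExpPencilCount → RankOneFourLaw` — part 1/6 — toric push-forwards and the Segre substitution (Parts T1–T2)

(T1) monomial substitutions `Y_i ↦ Y^{M i}` between polynomial rings — the toric push-forward `phiT M` on polynomials and `piT M` on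
exponents (`piT_eq_sum`, `phiT_monomial`, `coeff_phiT`, `exists_of_mem_support_phiT`, composition `piT_piT`/`phiT_phiT`, and the tree's planar
`phi/piE` as the case of a matrix `E`: `phi_eq_phiT`, `piE_eq_piT`); (T2) the four-index datum `FourIdx` (pairwise distinct `a b c d : σ`) and the
SEGRE SUBSTITUTION `segM I` (`Y_a ↦ Y_aY_c, Y_b ↦ Y_bY_d, Y_c ↦ Y_aY_d, Y_d ↦ Y_bY_c`, identity elsewhere) with its coordinate formulas
`piT_segM_a/b/c/d/other` and the relation `segM a + segM b = segM c + segM d` (`segM_rel`).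

PORT NOTE (val-lit-p11 g1, literature-prover seat, helper mode `--supports stmt-ValiantsHypothesis-5906 --as helper`, no stub credit
claimed): part 1/6 of a VERBATIM Theorems-side port of val-idea-8 g3's sorry-free module
`Cruxes/TwoProducts/Lines/relation_ladder_R6.lean` (tree @1dcc86cce347; file sha256 36828fc46563…; 1 653 lines; `lean check` rc 0, 0 sorries)
into files of ≤ 400 lines, as tasked by the val-lit desk (RULING #273 (b)). ALL mathematics and ALL proofs below are val-idea-8 g3's (engine
memo `Cruxes/TwoProducts/Lines/relation_ladder_R6_engine.md` rev 3); the port changes only: the file split, the import chain, two deprecated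
Mathlib names (`Finsupp.coe_finset_sum` → `Finsupp.coe_finsetSum`, `Finsupp.finset_sum_apply` → `Finsupp.finsetSum_apply`), `omit […] in`
annotations and one-line docstrings on 45 API lemmas required by the tree's zero-warning / docstring lint. Namespace = the author's
(`…Theorems.NewtonUnitEquations.TwoProducts.PermutationType`, as in the R3♯ port `…PermutationType{WeightOrder,Lifted,PushForward,Count,Family}`).
Nothing here closes the line's residual, the crux `TwoProducts` (5906) or `VP ≠ VNP`; no summit statement is proved.

Cut table (six files, texts VERBATIM, cut at the author's Part boundaries; line numbers of the source file):
(1/6) `…RankOneFourLawToric` = Parts T1–T2 (l. 53–295: toric push-forwards `phiT/piT`, the four-index datum `FourIdx`, the Segre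
substitution `segM`); (2/6) `…RankOneFourLawFibres` = Parts T3–T4 (l. 296–561: `fourSet/rest/ofFun/Balanced/xhat/Lof/KR`,
`multinomial_Lof`, binomial characters `binChar`, the tool interface `BinExpPencilCount` (verbatim copy), `bsum/bwidth`);
(3/6) `…RankOneFourLawSlice` = the slice section + Part T5 (l. 562–865: `termC/termA/termD/Fsl`, the coefficient theorem
`coeff_segre_logTrunc`, `xOf`, Lemma A `toric_minLog`); (4/6) `…RankOneFourLawPlanar` = Part T6 up to `lifted_of_visible`
(l. 867–1146: `RankOneCoincidences`, `RelData`, the refined push-forward `E'`, `GT`, `injOn_of_rankOne`); (5/6)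
`…RankOneFourLawWeights` = Part T6, the upstairs weights (l. 1147–1289: `rW/tPar/theta`, `theta_pos`, `lwt_theta_segM`,
`lwt_theta_balanced`) + Part T7's per-visible-point slicing `RelData.sliceMin_of_visible` (l. 1291–1412); (6/6) `…RankOneFourLawCount` =
Part T7, rest (l. 1413–1651: `sliceBd`, `RelData.count`, `arith_R6`, `RankOneFourLaw`, `rankOneFourLaw_of_binExpPencilCount`) + the
two-line WIRING `binExpPencilCount_holds`, `rankOneFourLaw` (val-lit-p3 g14's ✓ p620797 `…FormalLogLinearisationBinomialPencilCount`).

Honest scope (the author's): shapes `α = β + γ` (R6b), `2β = α + γ` (R6c) and coincidence rank `≥ 2` (R7) are NOT covered and go to the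
residual of skeleton v14. Nothing here moves VP ≠ VNP; `TwoProducts` (5906) stays OPEN. [folklore]
-/

noncomputable section

-- Sub = Summit single-conjunct layout: the duplicated namespace component is mandated by the tree.
set_option linter.dupNamespace false
set_option linter.unusedSimpArgs false

namespace Summit.ValiantsHypothesis.ValiantsHypothesis.Theorems.NewtonUnitEquations.TwoProducts.PermutationType
open scoped BigOperators
open MvPolynomial

variable {σ : Type*} [Fintype σ] [DecidableEq σ]

/-! ## Part T1: monomial substitutions `Y_i ↦ Y^{M i}` between polynomial rings (the toric push-forward) -/

section Toric
variable {τ : Type*} [Fintype τ] [DecidableEq τ] (M : σ → (τ →₀ ℕ))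

/-- The monomial substitution `Y_i ↦ Y^{M i}`. [folklore] -/
def phiT : MvPolynomial σ ℂ →ₐ[ℂ] MvPolynomial τ ℂ :=
  aeval fun i => (monomial (M i) (1 : ℂ) : MvPolynomial τ ℂ)

/-- The induced map on exponents. [folklore] -/
def piT (κ : σ →₀ ℕ) : τ →₀ ℕ := κ.sum fun i k => k • M i

omit [Fintype τ] [DecidableEq τ] [DecidableEq σ] in
/-- `piT` as a sum over the index type. [folklore] -/
theorem piT_eq_sum (κ : σ →₀ ℕ) : piT M κ = ∑ i, κ i • M i := by
  unfold piT; exact Finsupp.sum_fintype _ _ (fun _ => by simp)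

omit [Fintype σ] [DecidableEq σ] [Fintype τ] [DecidableEq τ] in
/-- `piT` is the `ℕ`-linear extension of `M`. [folklore] -/
theorem piT_eq_linearCombination (κ : σ →₀ ℕ) : piT M κ = Finsupp.linearCombination ℕ M κ :=
  (Finsupp.linearCombination_apply ℕ κ).symm

omit [Fintype σ] [DecidableEq σ] [Fintype τ] [DecidableEq τ] in
/-- Additivity of `piT`. [folklore] -/
theorem piT_add (κ κ' : σ →₀ ℕ) : piT M (κ + κ') = piT M κ + piT M κ' := by
  simp only [piT_eq_linearCombination, map_add]

omit [Fintype σ] [DecidableEq σ] [Fintype τ] [DecidableEq τ] in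
/-- `piT` of a multiple. [folklore] -/
theorem piT_nsmul (k : ℕ) (κ : σ →₀ ℕ) : piT M (k • κ) = k • piT M κ := by
  simp only [piT_eq_linearCombination, map_nsmul]

omit [Fintype σ] [DecidableEq σ] [Fintype τ] [DecidableEq τ] in
/-- `piT` of a single letter. [folklore] -/
theorem piT_single (i : σ) (k : ℕ) : piT M (Finsupp.single i k) = k • M i := by
  unfold piT; rw [Finsupp.sum_single_index]; exact zero_smul _ _

omit [Fintype σ] [DecidableEq σ] [Fintype τ] [DecidableEq τ] in
/-- `phiT` on monomials. [folklore] -/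
theorem phiT_monomial (κ : σ →₀ ℕ) (a : ℂ) : phiT M (monomial κ a) = monomial (piT M κ) a := by
  unfold phiT piT
  rw [aeval_monomial, monomial_finsupp_sum_index, MvPolynomial.algebraMap_eq]
  congr 1
  refine Finsupp.prod_congr fun i _ => ?_
  rw [monomial_pow, one_pow]

omit [Fintype σ] [DecidableEq σ] [Fintype τ] [DecidableEq τ] in
/-- `phiT` on a variable. [folklore] -/
theorem phiT_X (i : σ) : phiT M (X i) = monomial (M i) 1 := by
  rw [show (X i : MvPolynomial σ ℂ) = monomial (Finsupp.single i 1) 1 from rfl, phiT_monomial, piT_single, one_smul]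

omit [Fintype σ] [DecidableEq σ] [Fintype τ] [DecidableEq τ] in
/-- `phiT` as a sum over the support. [folklore] -/
theorem phiT_eq_sum (H : MvPolynomial σ ℂ) : phiT M H = ∑ κ ∈ H.support, monomial (piT M κ) (coeff κ H) := by
  conv_lhs => rw [as_sum H]
  rw [map_sum]
  exact Finset.sum_congr rfl fun κ _ => phiT_monomial M κ _

omit [Fintype σ] [DecidableEq σ] [Fintype τ] in
/-- Coefficients of a push-forward are fibre sums. [folklore] -/
theorem coeff_phiT (H : MvPolynomial σ ℂ) (x : τ →₀ ℕ) :
    coeff x (phiT M H) = ∑ κ ∈ H.support with piT M κ = x, coeff κ H := by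
  classical
  rw [phiT_eq_sum, coeff_sum, Finset.sum_filter]
  refine Finset.sum_congr rfl fun κ _ => ?_
  rw [coeff_monomial]

omit [Fintype σ] [DecidableEq σ] [Fintype τ] in
/-- A support point of a push-forward has a preimage in the support. [folklore] -/
theorem exists_of_mem_support_phiT (H : MvPolynomial σ ℂ) (x : τ →₀ ℕ) (hx : x ∈ (phiT M H).support) :
    ∃ κ ∈ H.support, piT M κ = x := by
  classical
  rw [mem_support_iff, coeff_phiT] at hx
  obtain ⟨κ, hκ, -⟩ := Finset.exists_ne_zero_of_sum_ne_zero hx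
  exact ⟨κ, (Finset.mem_filter.mp hκ).1, (Finset.mem_filter.mp hκ).2⟩

omit [Fintype σ] [DecidableEq σ] [Fintype τ] [DecidableEq τ] in
/-- The planar push-forward `phi` is the case `τ = Fin 2` of `phiT`. [folklore] -/
theorem phi_eq_phiT (E : σ → (Fin 2 →₀ ℕ)) : phi E = phiT E := rfl

omit [Fintype σ] [DecidableEq σ] [Fintype τ] [DecidableEq τ] in
/-- `piE` is the case `τ = Fin 2` of `piT`. [folklore] -/
theorem piE_eq_piT (E : σ → (Fin 2 →₀ ℕ)) (κ : σ →₀ ℕ) : piE E κ = piT E κ := rfl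

omit [Fintype σ] [DecidableEq σ] [Fintype τ] [DecidableEq τ] in
/-- Composition of monomial substitutions on exponents. [folklore] -/
theorem piT_piT {υ : Type*} (N : τ → (υ →₀ ℕ)) (κ : σ →₀ ℕ) :
    piT N (piT M κ) = piT (fun i => piT N (M i)) κ := by
  simp only [piT_eq_linearCombination]
  rw [← LinearMap.comp_apply]
  congr 1
  ext i
  simp [Finsupp.linearCombination_single]

omit [Fintype σ] [DecidableEq σ] [Fintype τ] [DecidableEq τ] in
/-- Composition of monomial substitutions on polynomials. [folklore] -/
theorem phiT_phiT {υ : Type*} (N : τ → (υ →₀ ℕ)) (H : MvPolynomial σ ℂ) :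
    phiT N (phiT M H) = phiT (fun i => piT N (M i)) H := by
  have : (phiT N).comp (phiT M) = phiT (fun i => piT N (M i)) := by
    refine algHom_ext fun i => ?_
    rw [AlgHom.comp_apply, phiT_X, phiT_monomial, phiT_X]
  rw [← AlgHom.comp_apply, this]

end Toric

/-! ## Part T2: the four-term relation data and the Segre substitution
`α ↦ Y_a Y_c`, `β ↦ Y_b Y_d`, `γ ↦ Y_a Y_d`, `δ ↦ Y_b Y_c`, other letters unchanged -/

/-- Four distinct indices (of the relation letters `α, β, γ, δ`). [folklore] -/
structure FourIdx (σ : Type*) where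
  /-- index of `α` (upstairs: `Z₁`) -/
  a : σ
  /-- index of `β` (upstairs: `Z₂`) -/
  b : σ
  /-- index of `γ` (upstairs: `W₁`) -/
  c : σ
  /-- index of `δ` (upstairs: `W₂`) -/
  d : σ
  hab : a ≠ b
  hac : a ≠ c
  had : a ≠ d
  hbc : b ≠ c
  hbd : b ≠ d
  hcd : c ≠ d

variable (I : FourIdx σ)

/-- The Segre substitution on letters. [folklore] -/
def segM (i : σ) : σ →₀ ℕ :=
  if i = I.a then Finsupp.single I.a 1 + Finsupp.single I.c 1
  else if i = I.b then Finsupp.single I.b 1 + Finsupp.single I.d 1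
  else if i = I.c then Finsupp.single I.a 1 + Finsupp.single I.d 1
  else if i = I.d then Finsupp.single I.b 1 + Finsupp.single I.c 1
  else Finsupp.single i 1

omit [Fintype σ] in
/-- The Segre substitution on `a`: `Y_a ↦ Y_a Y_c`. [folklore] -/
theorem segM_a : segM I I.a = Finsupp.single I.a 1 + Finsupp.single I.c 1 := by
  unfold segM; rw [if_pos rfl]

omit [Fintype σ] in
/-- The Segre substitution on `b`: `Y_b ↦ Y_b Y_d`. [folklore] -/
theorem segM_b : segM I I.b = Finsupp.single I.b 1 + Finsupp.single I.d 1 := by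
  unfold segM; rw [if_neg I.hab.symm, if_pos rfl]

omit [Fintype σ] in
/-- The Segre substitution on `c`: `Y_c ↦ Y_a Y_d`. [folklore] -/
theorem segM_c : segM I I.c = Finsupp.single I.a 1 + Finsupp.single I.d 1 := by
  unfold segM; rw [if_neg I.hac.symm, if_neg I.hbc.symm, if_pos rfl]

omit [Fintype σ] in
/-- The Segre substitution on `d`: `Y_d ↦ Y_b Y_c`. [folklore] -/
theorem segM_d : segM I I.d = Finsupp.single I.b 1 + Finsupp.single I.c 1 := by
  unfold segM; rw [if_neg I.had.symm, if_neg I.hbd.symm, if_neg I.hcd.symm, if_pos rfl]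

omit [Fintype σ] in
/-- The Segre substitution is the identity on every variable other than `a, b, c, d`. [folklore] -/
theorem segM_other (i : σ) (ha : i ≠ I.a) (hb : i ≠ I.b) (hc : i ≠ I.c) (hd : i ≠ I.d) :
    segM I i = Finsupp.single i 1 := by
  unfold segM; rw [if_neg ha, if_neg hb, if_neg hc, if_neg hd]

omit [Fintype σ] in
/-- The Segre substitution identifies the two sides of the relation: `M α + M β = M γ + M δ`. [folklore] -/
theorem segM_rel : segM I I.a + segM I I.b = segM I I.c + segM I I.d := by
  rw [segM_a, segM_b, segM_c, segM_d]; abel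

omit [Fintype σ] in
/-- Every `segM i` is nonzero. [folklore] -/
theorem segM_ne_zero (i : σ) : segM I i ≠ 0 := by
  unfold segM
  split_ifs <;> intro h
  · have := DFunLike.congr_fun h I.a; simp [I.hac.symm] at this
  · have := DFunLike.congr_fun h I.b; simp [I.hbd.symm] at this
  · have := DFunLike.congr_fun h I.a; simp [I.had.symm] at this
  · have := DFunLike.congr_fun h I.b; simp [I.hbc.symm] at this
  · have := DFunLike.congr_fun h i; simp at this

omit [DecidableEq σ] in
/-- Coordinates of a toric image, as a sum. [folklore] -/
theorem piT_apply {τ : Type*} (M : σ → (τ →₀ ℕ)) (L : σ →₀ ℕ) (j : τ) :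
    piT M L j = ∑ i, L i * (M i) j := by
  rw [piT_eq_sum, Finsupp.coe_finsetSum, Finset.sum_apply]
  simp only [Finsupp.coe_smul, Pi.smul_apply, smul_eq_mul]

/-- `Z₁`-coordinate of a toric image: `#α + #γ`. [folklore] -/
theorem piT_segM_a (L : σ →₀ ℕ) : piT (segM I) L I.a = L I.a + L I.c := by
  have F := And.intro I.hab (And.intro I.hac (And.intro I.had (And.intro I.hbc (And.intro I.hbd I.hcd))))
  rw [piT_apply]
  have key : ∀ i, L i * (segM I i) I.a = (if i = I.a then L i else 0) + (if i = I.c then L i else 0) := by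
    intro i
    unfold segM
    split_ifs with h1 h2 h3 h4 <;>
      simp [Finsupp.single_apply, h1, F.1, F.2.1, F.2.2.1, F.2.2.2.1, F.2.2.2.2.1, F.2.2.2.2.2,
        F.1.symm, F.2.1.symm, F.2.2.1.symm, F.2.2.2.1.symm, F.2.2.2.2.1.symm, F.2.2.2.2.2.symm] <;> simp_all
  simp only [key, Finset.sum_add_distrib, Finset.sum_ite_eq', Finset.mem_univ, if_true]

/-- `Z₂`-coordinate of a toric image: `#β + #δ`. [folklore] -/
theorem piT_segM_b (L : σ →₀ ℕ) : piT (segM I) L I.b = L I.b + L I.d := by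
  have F := And.intro I.hab (And.intro I.hac (And.intro I.had (And.intro I.hbc (And.intro I.hbd I.hcd))))
  rw [piT_apply]
  have key : ∀ i, L i * (segM I i) I.b = (if i = I.b then L i else 0) + (if i = I.d then L i else 0) := by
    intro i
    unfold segM
    split_ifs with h1 h2 h3 h4 <;>
      simp [Finsupp.single_apply, F.1, F.2.1, F.2.2.1, F.2.2.2.1, F.2.2.2.2.1, F.2.2.2.2.2,
        F.1.symm, F.2.1.symm, F.2.2.1.symm, F.2.2.2.1.symm, F.2.2.2.2.1.symm, F.2.2.2.2.2.symm] <;> simp_all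
  simp only [key, Finset.sum_add_distrib, Finset.sum_ite_eq', Finset.mem_univ, if_true]

/-- `W₁`-coordinate of a toric image: `#α + #δ`. [folklore] -/
theorem piT_segM_c (L : σ →₀ ℕ) : piT (segM I) L I.c = L I.a + L I.d := by
  have F := And.intro I.hab (And.intro I.hac (And.intro I.had (And.intro I.hbc (And.intro I.hbd I.hcd))))
  rw [piT_apply]
  have key : ∀ i, L i * (segM I i) I.c = (if i = I.a then L i else 0) + (if i = I.d then L i else 0) := by
    intro i
    unfold segM
    split_ifs with h1 h2 h3 h4 <;>
      simp [Finsupp.single_apply, F.1, F.2.1, F.2.2.1, F.2.2.2.1, F.2.2.2.2.1, F.2.2.2.2.2,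
        F.1.symm, F.2.1.symm, F.2.2.1.symm, F.2.2.2.1.symm, F.2.2.2.2.1.symm, F.2.2.2.2.2.symm] <;> simp_all
  simp only [key, Finset.sum_add_distrib, Finset.sum_ite_eq', Finset.mem_univ, if_true]

/-- `W₂`-coordinate of a toric image: `#β + #γ`. [folklore] -/
theorem piT_segM_d (L : σ →₀ ℕ) : piT (segM I) L I.d = L I.b + L I.c := by
  have F := And.intro I.hab (And.intro I.hac (And.intro I.had (And.intro I.hbc (And.intro I.hbd I.hcd))))
  rw [piT_apply]
  have key : ∀ i, L i * (segM I i) I.d = (if i = I.b then L i else 0) + (if i = I.c then L i else 0) := by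
    intro i
    unfold segM
    split_ifs with h1 h2 h3 h4 <;>
      simp [Finsupp.single_apply, F.1, F.2.1, F.2.2.1, F.2.2.2.1, F.2.2.2.2.1, F.2.2.2.2.2,
        F.1.symm, F.2.1.symm, F.2.2.1.symm, F.2.2.2.1.symm, F.2.2.2.2.1.symm, F.2.2.2.2.2.symm] <;> simp_all
  simp only [key, Finset.sum_add_distrib, Finset.sum_ite_eq', Finset.mem_univ, if_true]

/-- Other coordinates of a toric image are unchanged. [folklore] -/
theorem piT_segM_other (L : σ →₀ ℕ) (j : σ) (ha : j ≠ I.a) (hb : j ≠ I.b) (hc : j ≠ I.c) (hd : j ≠ I.d) :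
    piT (segM I) L j = L j := by
  have F := And.intro I.hab (And.intro I.hac (And.intro I.had (And.intro I.hbc (And.intro I.hbd I.hcd))))
  rw [piT_apply]
  have key : ∀ i, L i * (segM I i) j = (if i = j then L i else 0) := by
    intro i
    unfold segM
    split_ifs with h1 h2 h3 h4 <;>
      simp [Finsupp.single_apply, ha, hb, hc, hd, Ne.symm ha, Ne.symm hb, Ne.symm hc, Ne.symm hd,
        F.1, F.2.1, F.2.2.1, F.2.2.2.1, F.2.2.2.2.1, F.2.2.2.2.2,
        F.1.symm, F.2.1.symm, F.2.2.1.symm, F.2.2.2.1.symm, F.2.2.2.2.1.symm, F.2.2.2.2.2.symm] <;> simp_all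
  simp only [key]
  rw [Finset.sum_ite_eq']; simp

end Summit.ValiantsHypothesis.ValiantsHypothesis.Theorems.NewtonUnitEquations.TwoProducts.PermutationType

end
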